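import Summits.Ventures.PercRepro.Night2LocalD2FarPre

/-!
# PercRepro — the (6,4) cell `|E ∖ G| = 2` with a 4-set `C ⊆ G` of `ρ(G ∖ C) ≤ 2`: the covering certificate
(night-2, gen 15; THEOREM E of NIGHT-2-k0.md)

**`localShadowHall_d2_of_four`** — `G ∈ flatsQ M 5`, `|E ∖ G| = 2`, every member below `G` has `|G ∖ cl B| ≥ 2`,
and some `C` with `|C| ≤ 4` has `ρ(G ∖ C) ≤ 2` (`G = ℓ ∪ C` with `ℓ` a line — the `ℓ ⊕ U_{3,4}` shape, where the
pair-5 rule overloads) ⟹ `LocalShadowHall M 4 G`, by THEOREM C (`localShadowHall_of_cover_sum`).  (`C ⊆ G` is not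
needed: only `G ∖ C` enters.)

Structure: a member `B` has `ρ(B) = 4 ≤ ρ(B ∖ C) + |B ∩ C| ≤ 2 + |B ∩ C|` and `4 ≤ ρ(G ∖ B) ≤ 2 + |C ∖ B|`
(`four_le_rkN_sdiff_of_mem_membersIn`), so `|B ∩ C| = |C ∖ B| = 2` and `ρ(B ∖ C) = ρ(G ∖ C)`: `G ∖ C ⊆ cl B`
(`sdiff_subset_clF_of_member`).  Hence a covering set `B ∪ {z}` has `z ∈ C`, a covering preimage of `S` is `S ∖ z`
with `z ∈ S ∩ C`, and `|S ∩ C| = 3`: at most three covering preimages, each of weight `1/|E ∖ cl B| ≤ 1/4`, total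
`≤ 3/4 ≤ 5/6`.
-/

namespace PercRepro.Shadow

open Finset PerFlat ThmH

variable {α : Type*} [DecidableEq α] {M : Matroid α} [M.Finite]

/-- `|B ∩ C| = |C ∖ B| = 2` for a member `B` when `|C| ≤ 4` and `ρ(G ∖ C) ≤ 2`. -/
theorem card_inter_eq_two_of_member {G C : Finset α} (hc4 : C.card ≤ 4)
    (hr : rkN M (G \ C) ≤ 2) (hd : (gr M \ G).card = 2) {B : Finset α}
    (hB : B ∈ membersIn M (Uq M (4 + 2) 4) G) : (B ∩ C).card = 2 ∧ (C \ B).card = 2 := by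
  have hBU : B ∈ Uq M (4 + 2) 4 := (mem_membersIn.1 hB).1
  have hBG : B ⊆ G := (subset_clF hBU).trans (mem_membersIn.1 hB).2
  have hrB := rkN_eq_of_mem_Uq hBU
  have h4 := four_le_rkN_sdiff_of_mem_membersIn hd hB
  -- `ρ(B) ≤ ρ(B ∖ C) + |B ∩ C| ≤ 2 + |B ∩ C|`
  have h1 : rkN M B ≤ rkN M (G \ C) + (B ∩ C).card := by
    have hsub : B ⊆ (G \ C) ∪ (B ∩ C) := by
      intro e he
      rw [Finset.mem_union, Finset.mem_sdiff, Finset.mem_inter]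
      by_cases heC : e ∈ C
      · right; exact ⟨he, heC⟩
      · left; exact ⟨hBG he, heC⟩
    exact (rkN_mono (M := M) hsub).trans (rkN_union_le_rkN_add_card (M := M) _ _)
  -- `ρ(G ∖ B) ≤ 2 + |C ∖ B|`
  have h2 : rkN M (G \ B) ≤ rkN M (G \ C) + (C \ B).card := by
    have hsub : G \ B ⊆ (G \ C) ∪ (C \ B) := by
      intro e he
      rw [Finset.mem_sdiff] at he
      rw [Finset.mem_union, Finset.mem_sdiff, Finset.mem_sdiff]
      by_cases heC : e ∈ C
      · right; exact ⟨heC, he.2⟩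
      · left; exact ⟨he.1, heC⟩
    exact (rkN_mono (M := M) hsub).trans (rkN_union_le_rkN_add_card (M := M) _ _)
  have h3 : (B ∩ C).card + (C \ B).card = C.card := by
    rw [Finset.inter_comm, Finset.card_inter_add_card_sdiff]
  omega

/-- `G ∖ C ⊆ cl B` for a member `B` when `|C| ≤ 4` and `ρ(G ∖ C) ≤ 2`. -/
theorem sdiff_subset_clF_of_member {G C : Finset α} (hG : G ∈ flatsQ M (4 + 1))
    (hc4 : C.card ≤ 4) (hr : rkN M (G \ C) ≤ 2) (hd : (gr M \ G).card = 2) {B : Finset α}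
    (hB : B ∈ membersIn M (Uq M (4 + 2) 4) G) : G \ C ⊆ clF M B := by
  have hGg : G ⊆ gr M := (mem_flatsQ.1 hG).1
  have hBU : B ∈ Uq M (4 + 2) 4 := (mem_membersIn.1 hB).1
  have hBG : B ⊆ G := (subset_clF hBU).trans (mem_membersIn.1 hB).2
  have hrB := rkN_eq_of_mem_Uq hBU
  have h2 := (card_inter_eq_two_of_member hc4 hr hd hB).1
  -- `ρ(B ∖ C) = ρ(G ∖ C)`
  have hle : rkN M (B \ C) ≤ rkN M (G \ C) := rkN_mono (M := M) (Finset.sdiff_subset_sdiff hBG (le_refl _))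
  have hge : rkN M B ≤ rkN M (B \ C) + (B ∩ C).card := by
    have hsub : B ⊆ (B \ C) ∪ (B ∩ C) := by
      intro e he
      rw [Finset.mem_union, Finset.mem_sdiff, Finset.mem_inter]
      by_cases heC : e ∈ C
      · right; exact ⟨he, heC⟩
      · left; exact ⟨he, heC⟩
    exact (rkN_mono (M := M) hsub).trans (rkN_union_le_rkN_add_card (M := M) _ _)
  have heq : rkN M (B \ C) = rkN M (G \ C) := by omega
  have hcl := subset_closure_of_rkN_eq (M := M) (Finset.sdiff_subset.trans hGg)
    (Finset.sdiff_subset_sdiff hBG (le_refl _)) heq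
  intro e he
  have h1 : (e : α) ∈ M.closure ((B \ C : Finset α) : Set α) := hcl (Finset.mem_coe.2 he)
  have h2 : M.closure ((B \ C : Finset α) : Set α) ⊆ M.closure (B : Set α) :=
    M.closure_subset_closure (by exact_mod_cast (Finset.sdiff_subset : B \ C ⊆ B))
  have h3 : (e : α) ∈ ((clF M B : Finset α) : Set α) := by
    rw [coe_clF]
    exact h2 h1
  exact Finset.mem_coe.1 h3

open scoped Classical in
/-- A covering preimage of `S` is `S ∖ z` for a point `z ∈ S ∩ C`, and then `|S ∩ C| = 3`. -/
theorem exists_eq_erase_of_mem_coverPreimages {G C : Finset α} (hG : G ∈ flatsQ M (4 + 1))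
    (hc4 : C.card ≤ 4) (hr : rkN M (G \ C) ≤ 2) (hd : (gr M \ G).card = 2) {S B : Finset α}
    (hB : B ∈ coverPreimages M (Uq M (4 + 2) 4) G S) :
    (∃ z ∈ S ∩ C, B = S.erase z) ∧ (S ∩ C).card = 3 := by
  obtain ⟨hBm, hcov⟩ := mem_coverPreimages.1 hB
  have hBU : B ∈ Uq M (4 + 2) 4 := (mem_membersIn.1 hBm).1
  obtain ⟨z, hz, rfl⟩ := mem_coverSets.1 hcov
  have hzG : z ∈ G := (Finset.mem_sdiff.1 hz).1
  have hzcl : z ∉ clF M B := (Finset.mem_sdiff.1 hz).2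
  have hzB : z ∉ B := notMem_of_notMem_clF hBU hzcl
  have hzC : z ∈ C := by
    by_contra hzC
    exact hzcl (sdiff_subset_clF_of_member hG hc4 hr hd hBm (Finset.mem_sdiff.2 ⟨hzG, hzC⟩))
  have h2 := (card_inter_eq_two_of_member hc4 hr hd hBm).1
  refine ⟨⟨z, Finset.mem_inter.2 ⟨Finset.mem_insert_self _ _, hzC⟩, (Finset.erase_insert hzB).symm⟩, ?_⟩
  have : insert z B ∩ C = insert z (B ∩ C) := by
    rw [Finset.insert_inter_of_mem hzC]
  rw [this, Finset.card_insert_of_notMem (fun h => hzB (Finset.mem_inter.1 h).1), h2]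

open scoped Classical in
/-- At most three covering preimages at every `S`. -/
theorem card_coverPreimages_le_three_of_four {G C : Finset α} (hG : G ∈ flatsQ M (4 + 1))
    (hc4 : C.card ≤ 4) (hr : rkN M (G \ C) ≤ 2) (hd : (gr M \ G).card = 2) (S : Finset α) :
    (coverPreimages M (Uq M (4 + 2) 4) G S).card ≤ 3 := by
  by_cases hne : (coverPreimages M (Uq M (4 + 2) 4) G S).Nonempty
  · obtain ⟨B₀, hB₀⟩ := hne
    have h3 := (exists_eq_erase_of_mem_coverPreimages hG hc4 hr hd hB₀).2
    have hsub : coverPreimages M (Uq M (4 + 2) 4) G S ⊆ (S ∩ C).image (fun z => S.erase z) := by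
      intro B hB
      obtain ⟨⟨z, hz, rfl⟩, -⟩ := exists_eq_erase_of_mem_coverPreimages hG hc4 hr hd hB
      exact Finset.mem_image.2 ⟨z, hz, rfl⟩
    calc (coverPreimages M (Uq M (4 + 2) 4) G S).card ≤ ((S ∩ C).image (fun z => S.erase z)).card :=
          Finset.card_le_card hsub
      _ ≤ (S ∩ C).card := Finset.card_image_le
      _ = 3 := h3
  · rw [Finset.not_nonempty_iff_eq_empty] at hne
    rw [hne]
    simp

open scoped Classical in
/-- **THEOREM E — the (6,4) cell `|E ∖ G| = 2` with a 4-set `C ⊆ G` of `ρ(G ∖ C) ≤ 2`.**  `G ∈ flatsQ M 5`,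
`|E ∖ G| = 2`, every member below `G` has `|G ∖ cl B| ≥ 2`, and some `C` with `|C| ≤ 4` has `ρ(G ∖ C) ≤ 2`
⟹ (LI_G). -/
theorem localShadowHall_d2_of_four {G : Finset α} (hG : G ∈ flatsQ M (4 + 1))
    (hd : (gr M \ G).card = 2)
    (hm2 : ∀ B ∈ membersIn M (Uq M (4 + 2) 4) G, 2 ≤ (G \ clF M B).card)
    {C : Finset α} (hc4 : C.card ≤ 4) (hr : rkN M (G \ C) ≤ 2) :
    LocalShadowHall M 4 G := by
  have hGg : G ⊆ gr M := (mem_flatsQ.1 hG).1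
  apply localShadowHall_of_cover_sum hG
  intro S _
  have hterm : ∀ B ∈ coverPreimages M (Uq M (4 + 2) 4) G S,
      (1 : ℚ) / ((gr M \ clF M B).card : ℚ) ≤ 1 / 4 := by
    intro B hB
    have hBm := (mem_coverPreimages.1 hB).1
    have hc : (gr M \ clF M B).card = (G \ clF M B).card + 2 :=
      card_sdiff_clF_eq_add hGg (mem_membersIn.1 hBm).2 |>.trans (by rw [hd])
    have h4 : 4 ≤ (gr M \ clF M B).card := by
      have := hm2 B hBm
      omega
    have h4' : (4 : ℚ) ≤ ((gr M \ clF M B).card : ℚ) := by exact_mod_cast h4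
    exact one_div_le_one_div_of_le (by norm_num) h4'
  have hcard := card_coverPreimages_le_three_of_four hG hc4 hr hd S
  calc ∑ B ∈ coverPreimages M (Uq M (4 + 2) 4) G S, (1 : ℚ) / ((gr M \ clF M B).card : ℚ)
      ≤ ∑ B ∈ coverPreimages M (Uq M (4 + 2) 4) G S, (1 / 4 : ℚ) := Finset.sum_le_sum hterm
    _ = ((coverPreimages M (Uq M (4 + 2) 4) G S).card : ℚ) * (1 / 4) := by
        rw [Finset.sum_const, nsmul_eq_mul]
    _ ≤ 3 * (1 / 4) := by
        apply mul_le_mul_of_nonneg_right _ (by norm_num)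
        exact_mod_cast hcard
    _ ≤ ((4 : ℕ) + 1 : ℚ) / ((4 : ℕ) + 2) := by norm_num

end PercRepro.Shadow
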